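import Mathlib
import Summits.Ventures.PercRepro2.Tail2DBlockCalc
import Summits.Ventures.PercRepro2.Tail2DHarrisSP
import Summits.Ventures.PercRepro2.Tail2DFlowOneBlocks
import Summits.Ventures.PercRepro2.Tail2DFlowOneStep01
import Summits.Ventures.PercRepro2.Tail2DParFin
import Summits.Ventures.PercRepro2.Tail2DParFinFlip
import Summits.Ventures.PercRepro2.Tail2DParFinTop
import Summits.Ventures.PercRepro2.Tail2DParFinDiag
import Summits.Ventures.PercRepro2.Tail2DParFinCount
import Summits.Ventures.PercRepro2.Tail2DParFinRelax
import Summits.Ventures.PercRepro2.Tail2DParFinSubTop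
import Summits.Ventures.PercRepro2.Tail2DParFinSubTopB
import Summits.Ventures.PercRepro2.Tail2DParFinFibres
import Summits.Ventures.PercRepro2.Tail2DOneChange
import Summits.Ventures.PercRepro2.Tail2DOneChangeB
import Summits.Ventures.PercRepro2.Tail2DOneChangeC
import Summits.Ventures.PercRepro2.Tail2DFourIdent
import Summits.Ventures.PercRepro2.Tail2DEig31Ident
import Summits.Ventures.PercRepro2.Tail2DEig31IdentS1
import Summits.Ventures.PercRepro2.Tail2DEig31IdentS2
import Summits.Ventures.PercRepro2.Tail2DEig31IdentT1
import Summits.Ventures.PercRepro2.Tail2DEig31IdentT2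

/-!
# (SD) at `(3,1)` on `8` identical flow-one factors — the source and target identities and the theorem (Z)
(seat mine-b, cell pub-perc-repro2; conjectures/MINE-B.md §44)
-/

namespace Summit.Ventures.PercRepro2.Tail2D

open V2Closure Finset

namespace IdentEig31

variable {Y : V2Closure.SP}

/-- **the source identity** -/
theorem ratesN_srcOK (hR : 0 < (rSet Y).card) : (ratesN Y).SrcOK (fun _ => Y) 3 1 := by
  intro w hw
  have h3 := nR_add_nB_add_nC 8 w
  obtain ⟨r, hr⟩ : ∃ r, nR 8 w = r := ⟨_, rfl⟩
  obtain ⟨b, hb⟩ : ∃ b, nB 8 w = b := ⟨_, rfl⟩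
  have hr1 : 3 ≤ r := by have := hw.1; omega
  have hb1 : 1 ≤ b := by have := hw.2; omega
  have hr2 : r ≤ 8 := by omega
  have hb2 : b ≤ 8 := by omega
  interval_cases r <;> interval_cases b <;> first | exact src_3_1 hR w hr hb | exact src_4_1 hR w hr hb | exact src_5_1 hR w hr hb | exact src_6_1 hR w hr hb | exact src_7_1 hR w hr hb | exact src_3_2 hR w hr hb | exact src_4_2 hR w hr hb | exact src_5_2 hR w hr hb | exact src_6_2 hR w hr hb | exact src_3_3 hR w hr hb | exact src_4_3 hR w hr hb | exact src_5_3 hR w hr hb | exact src_3_4 hR w hr hb | exact src_4_4 hR w hr hb | exact src_3_5 hR w hr hb | omega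

/-- **the target identity** -/
theorem ratesN_tgtOK (hY : FlowOne Y) (hR : 0 < (rSet Y).card) : (ratesN Y).TgtOK (fun _ => Y) 3 1 := by
  intro w0 ht
  have h3 := nR_add_nB_add_nC 8 w0
  obtain ⟨r, hr⟩ : ∃ r, nR 8 w0 = r := ⟨_, rfl⟩
  obtain ⟨b, hb⟩ : ∃ b, nB 8 w0 = b := ⟨_, rfl⟩
  have hr1 : 2 ≤ r := by have := ht.1; omega
  have hb1 : 2 ≤ b := by have := ht.2; omega
  have hr2 : r ≤ 8 := by omega
  have hb2 : b ≤ 8 := by omega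
  interval_cases r <;> interval_cases b <;> first | exact tgt_2_2 hY hR w0 hr hb | exact tgt_3_2 hY hR w0 hr hb | exact tgt_4_2 hY hR w0 hr hb | exact tgt_5_2 hY hR w0 hr hb | exact tgt_6_2 hY hR w0 hr hb | exact tgt_2_3 hY hR w0 hr hb | exact tgt_3_3 hY hR w0 hr hb | exact tgt_4_3 hY hR w0 hr hb | exact tgt_5_3 hY hR w0 hr hb | exact tgt_2_4 hY hR w0 hr hb | exact tgt_3_4 hY hR w0 hr hb | exact tgt_4_4 hY hR w0 hr hb | exact tgt_2_5 hY hR w0 hr hb | exact tgt_3_5 hY hR w0 hr hb | exact tgt_2_6 hY hR w0 hr hb | omega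

/-- **(SD) at `(3,1)` on `8` identical factors** -/
theorem sdomZ_ident_Eig31 (hY : FlowOne Y) (hR : 0 < (rSet Y).card) : SDomZ (parFin 8 (fun _ => Y)) 3 1 :=
  sdomZ_of_oneChange (fun _ => hY) (fun _ => hR) (by norm_num) (ratesN Y) (ratesN_iota_nonneg hR)
    (ratesN_f_nonneg hR) (ratesN_x_nonneg hR) (ratesN_srcOK hR) (ratesN_tgtOK hY hR)

end IdentEig31

end Summit.Ventures.PercRepro2.Tail2D
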